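import Mathlib
import Summits.ResolutionOfSingularities.ResolutionOfSingularities.Theorems.SyzygyFlatteningDefs
import HarnessLib

/-!
# The syzygy-flattening tower: every stage contains the model and lies in the valuation ring

Crux `SyzygyFlattening.HigherRankTermination` (stmt-ResolutionOfSingularities-17045), line
`birth`, registered stub `stub_towerStage_basic`.

For a valuation ring `O ⊇ k` of `K` and a `k`-subalgebra `B ⊆ O` of `K`, each of the three
pieces of the operator `step O = locAt O ∘ nrm ∘ chart O` enlarges `B` and stays inside `O`:

* `self_le_locAt`, `locAt_toSubring_le`: `B ≤ locAt O B ⊆ O` (`b = b * 1⁻¹`; a generator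
  `a * s⁻¹` has `a ∈ B ⊆ O` and `s⁻¹ ∈ O`);
* `self_le_chart`, `chart_toSubring_le`: `B ≤ chart O B ⊆ O` (the adjoined Plücker ratios
  `det (ι g) / det (ι x)` lie in `O` by the `O`-minimality of `x`);
* `self_le_nrm`, `nrm_toSubring_le`: `B ≤ nrm B ⊆ O` (an element of `K` integral over `B ⊆ O`
  is integral over `O`, and `O` is integrally closed in `K = Frac O`:
  `mem_valuationSubring_of_isIntegral`).

Hence `self_le_step`, `step_toSubring_le`, and by induction on `m` the two invariants of the
tower `self_le_tower : A ≤ tower O A m` and `tower_toSubring_le : tower O A m ⊆ O`, packaged as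
the registered stub `stub_towerStage_basic`. The common tool is
`adjoin_toSubring_le_valuationSubring`: `Algebra.adjoin k s ⊆ O` as soon as `k ⊆ O` and
`s ⊆ O`. [folklore]
-/

noncomputable section

-- single-problem summit: the doubled namespace component `ResolutionOfSingularities` is forced
set_option linter.dupNamespace false

namespace Summit.ResolutionOfSingularities.ResolutionOfSingularities.Theorems.SyzygyFlattening

variable {k K : Type} [Field k] [Field K] [Algebra k K]

/-! ## Adjoining elements of `O` to `k ⊆ O` stays inside `O` -/

/-- If `k ⊆ O` and `s ⊆ O` then the `k`-subalgebra of `K` generated by `s` lies in `O`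
(`adjoin k s` is the subring generated by `k ∪ s`). [folklore] -/
theorem adjoin_toSubring_le_valuationSubring (O : ValuationSubring K)
    (hk : ∀ c : k, algebraMap k K c ∈ O) {s : Set K} (hs : s ⊆ O) :
    (Algebra.adjoin k s).toSubring ≤ O.toSubring := by
  rw [Algebra.adjoin_eq_ring_closure]
  refine Subring.closure_le.mpr ?_
  rintro y (⟨c, rfl⟩ | hy)
  · exact hk c
  · exact hs hy

/-! ## Localisation at the centre: `B ≤ locAt O B ⊆ O` -/

/-- Every `k`-subalgebra `B` of `K` is contained in its localisation `locAt O B` at the centre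
of `O`: `b = b * 1⁻¹` with `1 ∈ B` and `1⁻¹ = 1 ∈ O`. [folklore] -/
theorem self_le_locAt (O : ValuationSubring K) (B : Subalgebra k K) : B ≤ locAt O B := by
  intro b hb
  refine Algebra.subset_adjoin ⟨b, hb, 1, B.one_mem, ?_, ?_⟩
  · rw [inv_one]
    exact O.one_mem
  · rw [inv_one, mul_one]

/-- For `B ⊆ O` (and `k ⊆ O`) the localisation `locAt O B` lies in `O`: a generator `a * s⁻¹`
has `a ∈ B ⊆ O` and `s⁻¹ ∈ O`. [folklore] -/
theorem locAt_toSubring_le (O : ValuationSubring K) {B : Subalgebra k K}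
    (hk : ∀ c : k, algebraMap k K c ∈ O) (hB : B.toSubring ≤ O.toSubring) :
    (locAt O B).toSubring ≤ O.toSubring := by
  refine adjoin_toSubring_le_valuationSubring O hk ?_
  rintro y ⟨a, ha, s, -, hsO, rfl⟩
  exact mul_mem (hB (Subalgebra.mem_toSubring.mpr ha)) hsO

/-! ## The syzygy-flattening chart: `B ≤ chart O B ⊆ O` -/

/-- Every `k`-subalgebra `B` of `K` is contained in its chart `chart O B = adjoin (B ∪ ⋯)`.
[folklore] -/
theorem self_le_chart (O : ValuationSubring K) (B : Subalgebra k K) : B ≤ chart O B :=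
  fun _ hb => Algebra.subset_adjoin (Or.inl hb)

/-- Every adjoined Plücker ratio `det (ι g) / det (ι x)` lies in `O`, by the `O`-minimality of
the tuple `x`. [folklore] -/
theorem chartSet_subset (O : ValuationSubring K) (B : Subalgebra k K) :
    chartSet O B ⊆ O := by
  rintro y ⟨b, d, ε, r, ι, -, -, -, -, -, g, x, -, hmin, rfl⟩
  exact hmin g

/-- For `B ⊆ O` (and `k ⊆ O`) the chart `chart O B` lies in `O`: `B ⊆ O` by hypothesis and the
adjoined ratios are in `O` by minimality (`chartSet_subset`). [folklore] -/
theorem chart_toSubring_le (O : ValuationSubring K) {B : Subalgebra k K}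
    (hk : ∀ c : k, algebraMap k K c ∈ O) (hB : B.toSubring ≤ O.toSubring) :
    (chart O B).toSubring ≤ O.toSubring := by
  refine adjoin_toSubring_le_valuationSubring O hk ?_
  rintro y (hy | hy)
  · exact hB (Subalgebra.mem_toSubring.mpr hy)
  · exact chartSet_subset O B hy

/-! ## Normalisation: `B ≤ nrm B ⊆ O` -/

/-- Every `k`-subalgebra `B` of `K` is contained in its normalisation `nrm B`: elements of `B`
are integral over `B`. [folklore] -/
theorem self_le_nrm (B : Subalgebra k K) : B ≤ nrm B :=
  fun b hb => Algebra.subset_adjoin (isIntegral_algebraMap (R := ↥B) (A := K) (x := ⟨b, hb⟩))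

/-- An element of `K` integral over a subring `B ⊆ O` of the valuation ring `O` lies in `O`:
it is integral over `O`, and `O` is integrally closed in its fraction field `K`. [folklore] -/
theorem mem_valuationSubring_of_isIntegral (O : ValuationSubring K) {B : Subalgebra k K}
    (hB : B.toSubring ≤ O.toSubring) {y : K} (hy : IsIntegral ↥B y) : y ∈ O := by
  -- the inclusion `B → O` as a ring homomorphism
  let φ : ↥B →+* ↥O :=
    { toFun := fun b => ⟨(b : K), hB (Subalgebra.mem_toSubring.mpr b.2)⟩
      map_one' := rfl
      map_mul' := fun _ _ => rfl
      map_zero' := rfl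
      map_add' := fun _ _ => rfl }
  have hφ : (algebraMap ↥O K).comp φ = (RingHom.id K).comp (algebraMap ↥B K) :=
    RingHom.ext fun _ => rfl
  have hy' : IsIntegral ↥O y := hy.map_of_comp_eq φ (RingHom.id K) hφ
  obtain ⟨o, ho⟩ := IsIntegrallyClosed.algebraMap_eq_of_integral hy'
  rw [← ho]
  exact o.2

/-- For `B ⊆ O` (and `k ⊆ O`) the normalisation `nrm B` lies in `O`
(`mem_valuationSubring_of_isIntegral`). [folklore] -/
theorem nrm_toSubring_le (O : ValuationSubring K) {B : Subalgebra k K}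
    (hk : ∀ c : k, algebraMap k K c ∈ O) (hB : B.toSubring ≤ O.toSubring) :
    (nrm B).toSubring ≤ O.toSubring :=
  adjoin_toSubring_le_valuationSubring O hk fun _ hy => mem_valuationSubring_of_isIntegral O hB hy

/-! ## One step, and the tower -/

/-- Every `k`-subalgebra `B` of `K` is contained in `step O B = locAt O (nrm (chart O B))`.
[folklore] -/
theorem self_le_step (O : ValuationSubring K) (B : Subalgebra k K) : B ≤ step O B :=
  (self_le_chart O B).trans ((self_le_nrm (chart O B)).trans (self_le_locAt O (nrm (chart O B))))

/-- For `B ⊆ O` (and `k ⊆ O`) the next stage `step O B` lies in `O`. [folklore] -/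
theorem step_toSubring_le (O : ValuationSubring K) {B : Subalgebra k K}
    (hk : ∀ c : k, algebraMap k K c ∈ O) (hB : B.toSubring ≤ O.toSubring) :
    (step O B).toSubring ≤ O.toSubring :=
  locAt_toSubring_le O hk (nrm_toSubring_le O hk (chart_toSubring_le O hk hB))

/-- The stages increase: `tower O A m ≤ tower O A (m + 1)`. [folklore] -/
theorem tower_le_tower_succ (O : ValuationSubring K) (A : Subalgebra k K) (m : ℕ) :
    tower O A m ≤ tower O A (m + 1) :=
  self_le_step O (tower O A m)

/-- Every stage of the tower contains the model: `A ≤ tower O A m`. [folklore] -/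
theorem self_le_tower (O : ValuationSubring K) (A : Subalgebra k K) (m : ℕ) :
    A ≤ tower O A m := by
  induction m with
  | zero => exact self_le_locAt O A
  | succ m ih => exact ih.trans (tower_le_tower_succ O A m)

/-- The stages are monotone in the index: `tower O A m ≤ tower O A n` for `m ≤ n`. [folklore] -/
theorem tower_mono (O : ValuationSubring K) (A : Subalgebra k K) {m n : ℕ} (h : m ≤ n) :
    tower O A m ≤ tower O A n := by
  induction h with
  | refl => exact le_rfl
  | step _ ih => exact ih.trans (tower_le_tower_succ O A _)

/-- For `A ⊆ O` (and `k ⊆ O`) every stage of the tower lies in `O`: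
`(tower O A m).toSubring ≤ O.toSubring`. [folklore] -/
theorem tower_toSubring_le (O : ValuationSubring K) {A : Subalgebra k K}
    (hk : ∀ c : k, algebraMap k K c ∈ O) (hA : A.toSubring ≤ O.toSubring) (m : ℕ) :
    (tower O A m).toSubring ≤ O.toSubring := by
  induction m with
  | zero => exact locAt_toSubring_le O hk hA
  | succ m ih => exact step_toSubring_le O hk ih

/-- **Registered stub `stub_towerStage_basic`** (crux stmt-ResolutionOfSingularities-17045, line
`birth`). Every stage of the tower contains the model and lies in the valuation ring:
`A ≤ tower O A m` and `tower O A m ⊆ O` (the adjoined ratios are in `O` by minimality, integral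
elements over a subring of `O` are in `O` because `O` is integrally closed in `K`, and `locAt`
only inverts elements whose inverse is in `O`). [folklore] -/
theorem stub_towerStage_basic : ∀ (k K : Type) [Field k] [Field K] [Algebra k K]
    (O : ValuationSubring K) (A : Subalgebra k K), (∀ c : k, algebraMap k K c ∈ O) →
      A.toSubring ≤ O.toSubring → ∀ m : ℕ, A ≤ tower O A m ∧ (tower O A m).toSubring ≤ O.toSubring :=
  fun _ _ _ _ _ O A hk hA m => ⟨self_le_tower O A m, tower_toSubring_le O hk hA m⟩

end Summit.ResolutionOfSingularities.ResolutionOfSingularities.Theorems.SyzygyFlattening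

end
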